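import Summits.HodgeConjecture.HodgeConjecture.Theorems.CyclicUnitaryPowersPatternWords

/-!
# Pair placements: the contraction tensors of the GL first fundamental theorem as tensors, in any basis

Helper for stub L `stub_deckUnitaryInvariantsMatching` of the crux `PowersHodgeOfDeckCommutators`
(stmt-HodgeConjecture-19545, route `CyclicUnitaryPowers`, line `unitary-kunneth-fft` v6, lane 2); sequel of
`CyclicUnitaryPowersPatternWords`.  For a block pattern `κ` (enumeration `e` of the positions off `E_0`) and a
colour-preserving bijection `β` from the vector positions to the covector positions, the contraction tensor `C_β` of
`ClassicalInvariants/TensorFFTGeneralLinear` (the indicator of the block-coordinate words constant along the pairs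
`(k, β k)`) defines the tensor
`pairTensor f κ e β = Σ_ν C_β(ν) • ⊗_q f (embWord κ e ν q)`
(the letter `x₀ = f none` at the positions of pattern `none`, and `Σ_a e_{i,a} ⊗ e^{i,a}` at each pair of colour `i`).

* §1 change of basis for tensor coordinates: `tcoord b' (tmon f w) u = Π_q b'.repr (f (w q)) (u q)`;
* §2 **the coordinates of `pairTensor` in ANY basis `b'`** (`tcoord_pairTensor`):
  `Π_{κ q = none} b'.repr x₀ (u q) · Π_{k vector} Kmat_{col k} (u (e k), u (e (β k)))` with the eigen-Casimir matrices
  `Kmat_i (α, α') = Σ_a b'.repr (e_{i,a}) α · b'.repr (e^{i,a}) α'` (computed in `CyclicUnitaryPowersCasimirMatrix`).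

Pure linear algebra (finite sums); no Hodge theory.
-/

noncomputable section

open Module Matrix
open scoped TensorProduct PiTensorProduct BigOperators

namespace Summit.HodgeConjecture.HodgeConjecture.Theorems.CyclicUnitaryPowersPairPlacement

open Literature.AlgebraicGeometry.Motives
open Literature.RepresentationTheory.ClassicalInvariants (contractionTensor contractionTensor_apply)
open Summit.HodgeConjecture.HodgeConjecture.Theorems.CyclicUnitaryPowersBlockAction
open Summit.HodgeConjecture.HodgeConjecture.Theorems.CyclicUnitaryPowersPatternWords

variable {K : Type*} [Field K] {W : Type*} [AddCommGroup W] [Module K W]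

/-! ### §1 Change of basis for tensor coordinates -/

section ChangeOfBasis

variable {L : Type*} [Fintype L] [DecidableEq L] {S : Type*} [Fintype S] [DecidableEq S]
  (f : Basis L K W) (b' : Basis S K W) {r : ℕ}

omit [Fintype L] [DecidableEq L] in
/-- Multilinear expansion of `⊗_q (Σ_a N a (w q) • b' a) ⊗ ()` for a rectangular coefficient array `N`. [folklore] -/
theorem tprod_sum_smul_tmul_rect (N : S → L → K) (w : Fin r → L) :
    (PiTensorProduct.tprod K fun q => ∑ a, N a (w q) • b' a) ⊗ₜ[K]
        (PiTensorProduct.tprod K fun l : Fin 0 => b'.dualBasis (noIdx l)) =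
      ∑ u : Fin r → S, (∏ q, N (u q) (w q)) • tmon b' u := by
  have hsum := (PiTensorProduct.tprod K (s := fun _ : Fin r => W)).map_sum (fun q a => N a (w q) • b' a)
  rw [hsum, TensorProduct.sum_tmul]
  refine Finset.sum_congr rfl fun u _ => ?_
  rw [MultilinearMap.map_smul_univ, ← TensorProduct.smul_tmul', tmon, hodgeTensorBasis_apply]

/-- **A basis tensor of `f` in the tensor basis of `b'`**: `⊗_q f (w q) = Σ_u (Π_q b'.repr (f (w q)) (u q)) • ⊗_q b' (u q)`.
[folklore] -/
theorem tmon_eq_sum_tmon (w : Fin r → L) :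
    tmon f w = ∑ u : Fin r → S, (∏ q, b'.repr (f (w q)) (u q)) • tmon b' u := by
  have hfun : (fun q => f (w q)) = fun q => ∑ a, (fun a l => b'.repr (f l) a) a (w q) • b' a :=
    funext fun q => (b'.sum_repr (f (w q))).symm
  rw [tmon, hodgeTensorBasis_apply, hfun,
    show (fun l : Fin 0 => f.dualBasis (noIdx l)) = fun l => b'.dualBasis (noIdx l) from funext fun i => Fin.elim0 i]
  exact tprod_sum_smul_tmul_rect b' (fun a l => b'.repr (f l) a) w

/-- Coordinates of a basis tensor of `f` in the basis `b'`: `Π_q b'.repr (f (w q)) (u q)`. [folklore] -/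
theorem tcoord_tmon_basis (w : Fin r → L) (u : Fin r → S) :
    tcoord b' (tmon f w) u = ∏ q, b'.repr (f (w q)) (u q) := by
  rw [tmon_eq_sum_tmon f b' w, tcoord_sum_smul]
  simp_rw [tcoord_tmon, mul_ite, mul_one, mul_zero]
  rw [Finset.sum_ite_eq Finset.univ u, if_pos (Finset.mem_univ _)]

end ChangeOfBasis

/-! ### §2 The pair tensor of a colour-preserving matching and its coordinates -/

section Pair

variable {h n : ℕ} (f : Basis (Option (Fin h × Bool × Fin n)) K W) {r : ℕ}
  (κ : Fin r → Option (Fin h × Bool)) {d : ℕ} (e : Fin d ≃ {q : Fin r // (κ q).isSome})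
  (β : {k : Fin d // patTy κ e k = true} ≃ {k : Fin d // patTy κ e k = false})

/-- **The pair tensor** of the matching `β`: `Σ_ν C_β(ν) • ⊗_q f (embWord κ e ν q)`. [folklore] -/
def pairTensor : hodgeTensorSpaceOver K W r 0 :=
  ∑ ν : Fin d → Fin n, contractionTensor K (patTy κ e) β ν • tmon f (embWord κ e ν)

/-- The glued block coordinates of a choice `μ` on the vector positions: `μ` there, `μ ∘ β⁻¹` on the covector
positions. [folklore] -/
def glue (μ : {k : Fin d // patTy κ e k = true} → Fin n) : Fin d → Fin n := fun k =>
  if hk : patTy κ e k = true then μ ⟨k, hk⟩ else μ (β.symm ⟨k, by simpa using hk⟩)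

/-- `glue μ` is constant along the pairs. [folklore] -/
theorem glue_pair (μ : {k : Fin d // patTy κ e k = true} → Fin n) (a : {k : Fin d // patTy κ e k = true}) :
    glue κ e β μ a = glue κ e β μ (β a) := by
  unfold glue
  rw [dif_pos a.2, dif_neg (by simpa using (β a).2)]
  congr 1
  apply β.injective
  rw [Equiv.apply_symm_apply]

/-- `glue` is injective. [folklore] -/
theorem glue_injective : Function.Injective (glue (n := n) κ e β) := by
  intro μ μ' hμ
  funext a
  have h := congrFun hμ a
  unfold glue at h
  rw [dif_pos a.2, dif_pos a.2] at h
  simpa using h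

/-- A word constant along the pairs is glued from its values on the vector positions. [folklore] -/
theorem glue_restrict {ν : Fin d → Fin n} (hν : ∀ a : {k // patTy κ e k = true}, ν a = ν (β a)) :
    glue κ e β (fun a => ν a) = ν := by
  funext k
  unfold glue
  split_ifs with hk
  · rfl
  · have h := hν (β.symm ⟨k, by simpa using hk⟩)
    rw [Equiv.apply_symm_apply] at h
    exact h

/-- **Sum over the words constant along the pairs = sum over the glued words.** [folklore] -/
theorem sum_contractionTensor_mul {M : Type*} [AddCommMonoid M] [Module K M] (F : (Fin d → Fin n) → M) :
    ∑ ν, contractionTensor K (patTy κ e) β ν • F ν = ∑ μ : {k // patTy κ e k = true} → Fin n, F (glue κ e β μ) := by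
  classical
  have hF : ∀ ν, contractionTensor K (patTy κ e) β ν • F ν =
      (fun ν => if ∀ a : {k // patTy κ e k = true}, ν a = ν (β a) then F ν else 0) ν := by
    intro ν
    simp only [contractionTensor_apply]
    split_ifs <;> simp
  simp_rw [hF]
  rw [Literature.RepresentationTheory.ClassicalInvariants.sum_eq_sum_comp_of_injective (glue (n := n) κ e β)
    (glue_injective κ e β) _ fun ν hν => ?_]
  · refine Finset.sum_congr rfl fun μ _ => ?_
    simp only [glue_pair κ e β μ, implies_true, if_true]
  · exact if_neg fun hall => hν ⟨fun a => ν a, glue_restrict κ e β hall⟩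

variable {S : Type*} [Fintype S] [DecidableEq S] (b' : Basis S K W)

/-- The eigen-Casimir matrix of colour `i` in the basis `b'`: `Σ_a b'.repr (e_{i,a}) α · b'.repr (e^{i,a}) α'`. [folklore] -/
def kmat (i : Fin h) : Matrix S S K := fun α α' =>
  ∑ a : Fin n, b'.repr (f (some (i, false, a))) α * b'.repr (f (some (i, true, a))) α'

/-- The kind component of the pattern at an enumerated position is the negation of `patTy`. [folklore] -/
theorem get_snd_eq (k : Fin d) : ((κ (e k)).get (e k).2).2 = !patTy κ e k := by
  simp [patTy]

/-- **Coordinates of the pair tensor in any basis `b'`.** [folklore] -/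
theorem tcoord_pairTensor (hβ : ∀ a, patCol κ e (β a) = patCol κ e a) (u : Fin r → S) :
    tcoord b' (pairTensor f κ e β) u =
      (∏ q : {q : Fin r // ¬ (κ q).isSome}, b'.repr (f none) (u q)) *
        ∏ a : {k // patTy κ e k = true}, kmat f b' (patCol κ e a) (u (e a)) (u (e (β a))) := by
  classical
  unfold pairTensor
  rw [tcoord_sum_smul]
  simp_rw [tcoord_tmon_basis]
  -- the factor over the positions of pattern `none`
  have hsplit : ∀ ν : Fin d → Fin n, ∏ q, b'.repr (f (embWord κ e ν q)) (u q) =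
      (∏ q : {q : Fin r // ¬ (κ q).isSome}, b'.repr (f none) (u q)) *
        ∏ k : Fin d, b'.repr (f (some (patCol κ e k, !patTy κ e k, ν k))) (u (e k)) := by
    intro ν
    rw [← Fintype.prod_subtype_mul_prod_subtype (fun q : Fin r => (κ q).isSome), mul_comm]
    congr 1
    · exact Fintype.prod_congr _ _ fun q => by rw [embWord_apply_of_not κ e _ q.2]
    · rw [← e.prod_comp]
      refine Fintype.prod_congr _ _ fun k => ?_
      rw [embWord_apply_coe, get_snd_eq]
      rfl
  have hsmul : ∀ ν : Fin d → Fin n, contractionTensor K (patTy κ e) β ν * ∏ q, b'.repr (f (embWord κ e ν q)) (u q) =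
      contractionTensor K (patTy κ e) β ν • ∏ q, b'.repr (f (embWord κ e ν q)) (u q) := fun ν => rfl
  simp_rw [hsmul, sum_contractionTensor_mul κ e β, hsplit, ← Finset.mul_sum]
  congr 1
  -- split each word product into vector and covector positions, reindex the covector ones by `β`
  have hvc : ∀ μ : {k // patTy κ e k = true} → Fin n,
      ∏ k : Fin d, b'.repr (f (some (patCol κ e k, !patTy κ e k, glue κ e β μ k))) (u (e k)) =
        ∏ a : {k // patTy κ e k = true},
          b'.repr (f (some (patCol κ e a, false, μ a))) (u (e a)) *
            b'.repr (f (some (patCol κ e a, true, μ a))) (u (e (β a))) := by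
    intro μ
    rw [← Fintype.prod_subtype_mul_prod_subtype (fun k : Fin d => patTy κ e k = true), Finset.prod_mul_distrib]
    congr 1
    · refine Fintype.prod_congr _ _ fun a => ?_
      rw [a.2, glue, dif_pos a.2]
      rfl
    · refine Fintype.prod_equiv ((Equiv.subtypeEquivRight fun k => by simp).trans β.symm) _ _ fun c => ?_
      have hc : patTy κ e c = false := by simpa using c.2
      have hE : (((Equiv.subtypeEquivRight fun k => by simp).trans β.symm) c :
          {k // patTy κ e k = true}) = β.symm ⟨c, hc⟩ := rfl
      have hβa : β (β.symm ⟨c, hc⟩) = ⟨c, hc⟩ := Equiv.apply_symm_apply β _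
      have h1 : patCol κ e ((β.symm ⟨c, hc⟩ : {k // patTy κ e k = true}) : Fin d) = patCol κ e c := by
        rw [← hβ, hβa]
      rw [hE, h1, hc, Bool.not_false, glue, dif_neg (by simp [hc]), hβa]
  simp_rw [hvc]
  unfold kmat
  rw [Finset.prod_univ_sum, Fintype.piFinset_univ]

end Pair

end Summit.HodgeConjecture.HodgeConjecture.Theorems.CyclicUnitaryPowersPairPlacement

end
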